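/-
Copyright (c) 2026. All rights reserved.
Released under Apache 2.0 license as described in the file LICENSE.
Authors: abc-iut cell, seat abc-iut-w5-d024 (gen 5).
-/
import Mathlib.Algebra.Group.Subgroup.Pointwise
import Mathlib.Topology.Algebra.Group.Basic
import Mathlib.Topology.Algebra.Group.Compact
import Literature.AnabelianGeometry.AbsoluteAnabelian.ProfiniteTerminology

/-!
# A complemented normal subgroup of a finitely generated group is finitely normally generated

Let `G` be a group generated by a finite set `S`, `P ⊴ G` a normal subgroup and `H ≤ G` a COMPLEMENT of
`P` (`H ⊔ P = ⊤`, `H ⊓ P = ⊥`). Writing each generator `s = x_s h_s` with `x_s ∈ P`, `h_s ∈ H`, the normal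
closure `N` of `{x_s}` satisfies `H N ∋ s` for all `s`, hence `H N = G` and `P = N (H ∩ P) = N`:
**`P` is the normal closure of at most `|S|` elements** (`Subgroup.eq_normalClosure_of_complement`).

The same argument in a compact Hausdorff topological group, with "generated" read as "topologically
generated" and `H` closed (so that `H · cl N` is closed), gives
`Subgroup.le_topologicalClosure_normalClosure_of_complement`: **a closed normal subgroup `P` of a
topologically finitely generated compact group which admits a closed complement is topologically generated
by the `G`-conjugates of a finite subset of `P`** (in the `hgen` form consumed by
`Literature.GroupTheory.exists_isOpen_inf_le_commutator_pow_closure_of_normalGenerators`).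

Motivation (abc-iut cell, GAP row G-L3d2g2-1 / fact F-1977 at `Γ_F`): for the absolute Galois group
`Γ_F` of a `p`-adic field, topologically finitely generated, the wild inertia group `P_F` is complemented
(the extension `1 → P_F → Γ_F → Γ_F/P_F → 1` splits, the tame quotient being `p`-projective), so `P_F` is
topologically finitely normally generated — the input of the elementary bounded-width route to the strong
completeness of `Γ_F`. Nothing in this file concerns a specific group; classical, Mathlib-only group
theory (plus the tree's terminology `IsTopologicallyFinitelyGenerated`). No definitions.

[cite: RibesZalesskii2010, §2.4–§2.5 (normal generation, complements in profinite groups)]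
-/

open scoped Pointwise

namespace Subgroup

variable {G : Type*} [Group G]

/-- The set of `G`-conjugates of a set `E`, in the explicit form `{g e g⁻¹}`, is Mathlib's
`Group.conjugatesOfSet E`. [cite: RibesZalesskii2010, §2.4] -/
theorem setOf_exists_conj_eq_conjugatesOfSet (E : Set G) :
    {x : G | ∃ g : G, ∃ e ∈ E, x = g * e * g⁻¹} = Group.conjugatesOfSet E := by
  ext x
  simp only [Set.mem_setOf_eq, Group.mem_conjugatesOfSet_iff, isConj_iff]
  constructor
  · rintro ⟨g, e, he, rfl⟩
    exact ⟨e, he, g, rfl⟩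
  · rintro ⟨e, he, g, rfl⟩
    exact ⟨g, e, he, rfl⟩

/-- Finite-set version of `setOf_exists_conj_eq_conjugatesOfSet` (membership in a `Finset`).
[cite: RibesZalesskii2010, §2.4] -/
theorem setOf_exists_conj_finset_eq_conjugatesOfSet (E : Finset G) :
    {x : G | ∃ g : G, ∃ e ∈ E, x = g * e * g⁻¹} = Group.conjugatesOfSet (E : Set G) := by
  rw [← setOf_exists_conj_eq_conjugatesOfSet]
  simp only [Finset.mem_coe]

/-- **Algebraic form.** Let `G` be generated by `S`, `P ⊴ G`, and `H ≤ G` with `H ⊓ P = ⊥`. Suppose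
each `s ∈ S` decomposes as `s = x_s * h_s` (`x_s ∈ P`, `h_s ∈ H`; automatic when `H ⊔ P = ⊤`). Then `P` is
the normal closure of `{x_s : s ∈ S}`. [cite: RibesZalesskii2010, §2.4] -/
theorem eq_normalClosure_of_complement (P H : Subgroup G) [P.Normal]
    (hinf : H ⊓ P = ⊥) (S : Set G) (hS : closure S = ⊤) (x h : G → G) (hx : ∀ s ∈ S, x s ∈ P)
    (hh : ∀ s ∈ S, h s ∈ H) (hxh : ∀ s ∈ S, s = x s * h s) :
    P = normalClosure (x '' S) := by
  classical
  -- the normal closure `N` of the `x_s` lies in `P`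
  set N : Subgroup G := normalClosure (x '' S) with hN
  have hNP : N ≤ P := normalClosure_le_normal (by rintro _ ⟨s, hs, rfl⟩; exact hx s hs)
  -- `N ⊔ H` contains every generator, hence is everything
  have htop : N ⊔ H = ⊤ := by
    rw [eq_top_iff, ← hS, closure_le]
    intro s hs
    rw [hxh s hs]
    exact mul_mem (mem_sup_left (subset_normalClosure ⟨s, hs, rfl⟩)) (mem_sup_right (hh s hs))
  refine le_antisymm ?_ hNP
  intro y hy
  have hy' : y ∈ ((N ⊔ H : Subgroup G) : Set G) := by rw [htop]; exact mem_top y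
  rw [normal_mul] at hy'
  obtain ⟨n, hn, k, hk, hnk⟩ := hy'
  -- `k = n⁻¹ (n k) ∈ H ∩ P = ⊥`
  have hkP : k ∈ P := by
    have := mul_mem (inv_mem (hNP hn)) (hnk ▸ hy)
    rwa [inv_mul_cancel_left] at this
  have hk1 : k = 1 := by
    have : k ∈ H ⊓ P := ⟨hk, hkP⟩
    rw [hinf] at this
    exact this
  rw [← hnk, hk1]
  simpa using hn

/-- **Algebraic form, finite version.** Under the hypotheses of `eq_normalClosure_of_complement` with a
finite generating set `S`, `P` is the normal closure of a finite subset `E ⊆ P` with `|E| ≤ |S|`.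
[cite: RibesZalesskii2010, §2.4] -/
theorem exists_finset_eq_normalClosure_of_complement (P H : Subgroup G) [P.Normal] (hsup : H ⊔ P = ⊤)
    (hinf : H ⊓ P = ⊥) (S : Finset G) (hS : closure (S : Set G) = ⊤) :
    ∃ E : Finset G, E.card ≤ S.card ∧ (E : Set G) ⊆ P ∧ P = normalClosure (E : Set G) := by
  classical
  -- decompose each element of `G` along `⊤ = P ⊔ H` (set-theoretically `P * H`)
  have hdec : ∀ g : G, ∃ x ∈ P, ∃ h ∈ H, g = x * h := by
    intro g
    have hg : g ∈ ((P ⊔ H : Subgroup G) : Set G) := by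
      rw [sup_comm, hsup]; exact mem_top g
    rw [normal_mul] at hg
    obtain ⟨x, hx, h, hh, rfl⟩ := hg
    exact ⟨x, hx, h, hh, rfl⟩
  choose x hx h hh hxh using hdec
  refine ⟨S.image x, Finset.card_image_le, ?_, ?_⟩
  · intro e he
    obtain ⟨s, -, rfl⟩ := Finset.mem_image.mp he
    exact hx s
  · rw [Finset.coe_image]
    exact eq_normalClosure_of_complement P H hinf S hS x h (fun s _ => hx s) (fun s _ => hh s)
      (fun s _ => hxh s)

/-! ### Topological form -/

variable [TopologicalSpace G] [IsTopologicalGroup G]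

/-- **Topological form.** Let `G` be a compact Hausdorff topological group topologically generated by
`S` (`cl ⟨S⟩ = G`), `P ⊴ G` a CLOSED normal subgroup and `H ≤ G` CLOSED with `H ⊓ P = ⊥`. If
`s = x_s * h_s` with `x_s ∈ P`, `h_s ∈ H` for `s ∈ S` (automatic when `H ⊔ P = ⊤`), then `P` is the
topological closure of the normal closure of `{x_s : s ∈ S}`: the subgroup `cl(N) · H` is closed (product
of two compact sets), contains `S`, hence is `G`, and `P = cl(N) · (H ∩ P) = cl(N)`.
[cite: RibesZalesskii2010, §2.5] -/
theorem eq_topologicalClosure_normalClosure_of_complement [CompactSpace G] [T2Space G]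
    (P H : Subgroup G) [P.Normal] (hPc : IsClosed (P : Set G)) (hHc : IsClosed (H : Set G))
    (hinf : H ⊓ P = ⊥) (S : Set G) (hS : (closure S).topologicalClosure = ⊤)
    (x h : G → G) (hx : ∀ s ∈ S, x s ∈ P) (hh : ∀ s ∈ S, h s ∈ H) (hxh : ∀ s ∈ S, s = x s * h s) :
    P = (normalClosure (x '' S)).topologicalClosure := by
  classical
  set N : Subgroup G := (normalClosure (x '' S)).topologicalClosure with hN
  haveI : (normalClosure (x '' S)).topologicalClosure.Normal := is_normal_topologicalClosure _
  have hNP : N ≤ P :=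
    topologicalClosure_minimal _
      (normalClosure_le_normal (by rintro _ ⟨s, hs, rfl⟩; exact hx s hs)) hPc
  -- `N ⊔ H` is closed: its carrier is the compact set `N * H`
  have hNc : IsClosed (N : Set G) := isClosed_topologicalClosure _
  have hNHc : IsClosed (((N ⊔ H : Subgroup G)) : Set G) := by
    rw [normal_mul]
    exact (hNc.isCompact.mul hHc.isCompact).isClosed
  -- `N ⊔ H` contains the generators, hence their closure, hence everything
  have htop : N ⊔ H = ⊤ := by
    rw [eq_top_iff, ← hS]
    refine topologicalClosure_minimal _ ?_ hNHc
    rw [closure_le]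
    intro s hs
    rw [hxh s hs]
    exact mul_mem (mem_sup_left (le_topologicalClosure _ (subset_normalClosure ⟨s, hs, rfl⟩)))
      (mem_sup_right (hh s hs))
  refine le_antisymm ?_ hNP
  intro y hy
  have hy' : y ∈ ((N ⊔ H : Subgroup G) : Set G) := by rw [htop]; exact mem_top y
  rw [normal_mul] at hy'
  obtain ⟨n, hn, k, hk, hnk⟩ := hy'
  have hkP : k ∈ P := by
    have := mul_mem (inv_mem (hNP hn)) (hnk ▸ hy)
    rwa [inv_mul_cancel_left] at this
  have hk1 : k = 1 := by
    have : k ∈ H ⊓ P := ⟨hk, hkP⟩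
    rw [hinf] at this
    exact this
  rw [← hnk, hk1]
  simpa using hn

/-- **Topological form, finite version, in the `{g e g⁻¹}` shape.** Let `G` be a compact Hausdorff
topological group topologically generated by a finite set `S`, `P ⊴ G` closed and `H` a closed complement
of `P`. Then there is a finite `E ⊆ P` with `|E| ≤ |S|` such that `P` is contained in (indeed equal to)
the closure of the subgroup generated by the `G`-conjugates `g e g⁻¹` (`g ∈ G`, `e ∈ E`) — the hypothesis
`hgen` of `Literature.GroupTheory.exists_isOpen_inf_le_commutator_pow_closure_of_normalGenerators`.
[cite: RibesZalesskii2010, §2.5] -/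
theorem exists_finset_le_topologicalClosure_conjugates_of_complement [CompactSpace G] [T2Space G]
    (P H : Subgroup G) [P.Normal] (hPc : IsClosed (P : Set G)) (hHc : IsClosed (H : Set G))
    (hsup : H ⊔ P = ⊤) (hinf : H ⊓ P = ⊥) (S : Finset G)
    (hS : (closure (S : Set G)).topologicalClosure = ⊤) :
    ∃ E : Finset G, E.card ≤ S.card ∧ (E : Set G) ⊆ P ∧
      P = (closure {y : G | ∃ g : G, ∃ e ∈ E, y = g * e * g⁻¹}).topologicalClosure := by
  classical
  have hdec : ∀ g : G, ∃ x ∈ P, ∃ h ∈ H, g = x * h := by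
    intro g
    have hg : g ∈ ((P ⊔ H : Subgroup G) : Set G) := by
      rw [sup_comm, hsup]; exact mem_top g
    rw [normal_mul] at hg
    obtain ⟨x, hx, h, hh, rfl⟩ := hg
    exact ⟨x, hx, h, hh, rfl⟩
  choose x hx h hh hxh using hdec
  refine ⟨S.image x, Finset.card_image_le, ?_, ?_⟩
  · intro e he
    obtain ⟨s, -, rfl⟩ := Finset.mem_image.mp he
    exact hx s
  · rw [setOf_exists_conj_finset_eq_conjugatesOfSet, Finset.coe_image]
    exact eq_topologicalClosure_normalClosure_of_complement P H hPc hHc hinf S hS x h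
      (fun s _ => hx s) (fun s _ => hh s) (fun s _ => hxh s)

end Subgroup

namespace Literature.GroupTheory

open Literature.AnabelianGeometry.AbsoluteAnabelian

variable {G : Type*} [Group G] [TopologicalSpace G] [IsTopologicalGroup G] [CompactSpace G] [T2Space G]

/-- **A complemented closed normal subgroup of a topologically finitely generated compact group is
topologically finitely normally generated.** If `G` is compact Hausdorff and topologically finitely
generated (`IsTopologicallyFinitelyGenerated G`, [AbsTopI] §0), `P ⊴ G` is closed and `H ≤ G` is a closed
complement of `P` (`H ⊔ P = ⊤`, `H ⊓ P = ⊥`; e.g. the image of a continuous splitting of `G → G ⧸ P`),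
then `P` is topologically generated by the `G`-conjugates of a finite subset `E ⊆ P`.
[cite: RibesZalesskii2010, §2.5] -/
theorem exists_normalGenerators_of_closed_complement (hG : IsTopologicallyFinitelyGenerated G)
    (P H : Subgroup G) [P.Normal] (hPc : IsClosed (P : Set G)) (hHc : IsClosed (H : Set G))
    (hsup : H ⊔ P = ⊤) (hinf : H ⊓ P = ⊥) :
    ∃ E : Finset G, (E : Set G) ⊆ P ∧
      P ≤ (Subgroup.closure {y : G | ∃ g : G, ∃ e ∈ E, y = g * e * g⁻¹}).topologicalClosure := by
  obtain ⟨S, hS⟩ := hG.exists_finset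
  obtain ⟨E, -, hEP, hPE⟩ :=
    Subgroup.exists_finset_le_topologicalClosure_conjugates_of_complement P H hPc hHc hsup hinf S hS
  exact ⟨E, hEP, hPE.le⟩

end Literature.GroupTheory
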